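import Summits.BirchSwinnertonDyer.BirchSwinnertonDyer.Theorems.PrintCFramBottomClassIndexLawFiveLeEisensteinTraceForm
import HarnessLib

/-!
# Crux `PrintCFram.BottomClassIndexLawFiveLe` (stmt-BirchSwinnertonDyer-20372), line `katz-genus-crossing`, research stub
# `stub_heegnerFieldPPart`: the Eisenstein trace form of the ODD-HEEGNER TWISTS `A(p)^{(D)}` at the CM-ramified prime —
# `a_ℓ(W) ≡ (ℓ/|D|)·(ℓ^{(p+1)/4} + ℓ^{(3p−1)/4}) (mod p)` for ANY model `W` of `A(p)^{(D)}`, `D ≡ 1 (mod 4)` squarefree, `p ∤ D`,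
# `p ∈ {11, 19, 43, 67, 163}` (cell `bsd-print-cfram`, width seat `bsd-line-cfram-p1-w2` g2; THEOREMS ONLY, `--supports` 20372;
# BSD is not proved by any of this)

HONEST FRAMING. Companion of `…EisensteinTraceForm.lean` (the leaf curves `A(11), A(19), A(43), A(67)`; `A(163)` is p611699,
`A(7)`-classes are cell `bsd-cm`'s Route U files). Nothing here is a statement about BSD. For the research stub (`BSD(W,p)` for a
CM member `W` at the ramified `p`, read over a Heegner field `K''` with `p` split), every Eisenstein-prime method over `K''`
consumes the residual representation `W[p]^{ss} ≅ 𝔽_p(ψ) ⊕ 𝔽_p(ψ⁻¹ω)` of the MEMBER, not of the leaf curve; the members of the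
five leaf classes at `p ≥ 11` that the sibling cell P2 («odd-Heegner bases») and Route U^{(p)} instantiate are the twists
`A(p)^{(D)}` by odd fundamental discriminants `D` prime to `p`, on an arbitrary (e.g. globally minimal) model. For those:

* `lFunction_twist_mod_of_traceForm` (generic): a mod-`p` trace form `a_ℓ(E) ≡ ℓ^{k₁} + ℓ^{k₂}` for a curve `E` with good
  reduction away from `p` transports to ANY model of `E^{(D)}` as `a_ℓ ≡ (ℓ/|D|)(ℓ^{k₁} + ℓ^{k₂})`, for every prime `ℓ ≠ p`
  (including `ℓ = 2` and `ℓ ∣ D`, where both sides vanish) — the Kronecker twisting formula `a_n(E^{(D)}) = (n/|D|) a_n(E)`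
  (`LFunction_quadraticTwist_apply_of_emod_four_eq_one`) and model invariance `LFunction_smul`; cell `bsd-cm`'s
  `RouteU.lFunction_twist_cm7_mod_seven` made generic.
* `lFunction_twist_cm11_mod`, `…cm19…`, `…cm43…`, `…cm67…`, `…cm163…`: the five instances, exponents
  `(3,8), (5,14), (11,32), (17,50), (41,122)` = `((p+1)/4, (3p−1)/4)`; so `ψ ∈ {χ_D ω^{(p+1)/4}, χ_D ω^{(3p−1)/4}}` as a
  `ℚ_p`-valued Dirichlet character, which is the `hss` input of `KrizLi2019.thm120_padicLogHeegner_unit_of_bernoulli`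
  (`RouteU.hss_of_traceForm` pattern) and the pair of characters whose Katz `p`-adic `L`-functions over `K''` a CGLS-type
  congruence would involve.
* `hss_of_traceForm_prime` (generic, any `p`, any exponents): cell `bsd-cm`'s `RouteU.hss_of_traceForm` (stated there at `p = 7`,
  exponents `(2,5)`) made generic — a mod-`p` trace form `a_ℓ ≡ ε_ℓ(ℓ^{k₁} + ℓ^{k₂})` plus the character identity
  `ψ(ℓ) + ψ⁻¹(ℓ)ω(ℓ) = ε_ℓ(ω(ℓ)^{k₁} + ω(ℓ)^{k₂})` (`ω` Teichmüller) give `‖a_ℓ − (ψ(ℓ) + ψ⁻¹(ℓ)ω(ℓ))‖_p < 1` at all `ℓ ∤ pN`;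
  and the five assembled instances `hss_twist_cm11`, …, `hss_twist_cm163` (the `Fact (Nat.Prime p)` instance is a binder, no
  instance is declared).

beyond-print theorem: NO (twisting formula, Silverman AEC X.2 Exercise 10.16; Gross 1980 Thm. 13.1.2 / Buhler–Gross 1985 (4.3)).
References: [SilvermanAEC2009] X.2, Exercise 10.16; [Mazur1978] Prop. 6.3 (1); [BuhlerGross1985] Ch. I (4.3); [KrizLi2019] Thm. 1.20, §2.
-/

noncomputable section

-- summit-side namespace `Summit.BirchSwinnertonDyer.BirchSwinnertonDyer.…` (single-conjunct summit, D-0017 layout)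
set_option linter.dupNamespace false

open scoped Classical
open NumberField IsDedekindDomain IsDedekindDomain.HeightOneSpectrum Field WeierstrassCurve
open Literature.NumberTheory.EllipticCurves Literature.NumberTheory.GaloisRepresentations
open Literature.NumberTheory.EllipticCurves.Rank1Residual
open Summit.BirchSwinnertonDyer.Rank1Residual
open Summit.BirchSwinnertonDyer.Rank1Residual.X12.O11

namespace Summit.BirchSwinnertonDyer.BirchSwinnertonDyer.Theorems.PrintCFram.EisensteinTraceForm

/-! ## The odd-Heegner twists `A(p)^{(D)}`: `a_ℓ(W) ≡ (ℓ/|D|)·(ℓ^{(p+1)/4} + ℓ^{(3p−1)/4}) (mod p)` -/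

/-- **Twisting a mod-`p` trace form (generic).** If `E/ℚ` has good reduction at every prime `≠ p` and a trace form
`a_ℓ(E) ≡ ℓ^{k₁} + ℓ^{k₂} (mod p)` at every prime `ℓ ≠ p`, then for ANY model `W` of the quadratic twist `E^{(D)}` by an odd
fundamental discriminant `D` (`D ≡ 1 (mod 4)` squarefree) with `p ∤ D`: `a_ℓ(W) ≡ (ℓ/|D|)·(ℓ^{k₁} + ℓ^{k₂}) (mod p)` for every prime
`ℓ ≠ p` — the Kronecker twisting formula `a_n(E^{(D)}) = (n/|D|)·a_n(E)` (`LFunction_quadraticTwist_apply_of_emod_four_eq_one`, ALL `n`,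
including `ℓ = 2` and `ℓ ∣ D`) and `LFunction_smul`. [cite: SilvermanAEC2009, X.2 and Exercise 10.16] -/
theorem lFunction_twist_mod_of_traceForm (E : WeierstrassCurve ℚ) [E.IsElliptic] (p : ℕ) [Fact p.Prime] (k₁ k₂ : ℕ)
    (hgood : ∀ (q : ℕ) [Fact q.Prime], q ≠ p → E.HasGoodReductionAtPrime q)
    (hbase : ∀ (ℓ : ℕ) [Fact ℓ.Prime], ℓ ≠ p → (E.LFunction ℓ : ZMod p) = (ℓ : ZMod p) ^ k₁ + (ℓ : ZMod p) ^ k₂)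
    (W : WeierstrassCurve ℚ) [W.IsElliptic] {D : ℤ} (hD4 : D % 4 = 1) (hsq : Squarefree D) (hpD : ¬ (p : ℤ) ∣ D)
    (hW : ∃ C : VariableChange ℚ, C • W = E.quadraticTwist (D : ℚ))
    (ℓ : ℕ) [hℓ : Fact ℓ.Prime] (hℓp : ℓ ≠ p) :
    ((W.LFunction ℓ : ℤ) : ZMod p) =
      (jacobiSym (ℓ : ℤ) D.natAbs : ZMod p) * ((ℓ : ZMod p) ^ k₁ + (ℓ : ZMod p) ^ k₂) := by
  obtain ⟨C, hC⟩ := hW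
  have hgoodv : ∀ v : HeightOneSpectrum (𝓞 ℚ), ((Rat.HeightOneSpectrum.primesEquiv v : ℕ) : ℤ) ∣ D →
      E.HasGoodReductionAt v := by
    intro v hvD
    refine hasGoodReductionAt_of_forall_ne E p hgood fun hpv => hpD ?_
    have h := (DeuringLadic.natCast_mem_asIdeal_iff v p).mp hpv
    have heq : (Rat.HeightOneSpectrum.primesEquiv v : ℕ) = p :=
      (Nat.prime_dvd_prime_iff_eq (Rat.HeightOneSpectrum.primesEquiv v).2 Fact.out).mp h
    rwa [heq] at hvD
  have h1 : W.LFunction ℓ = (E.quadraticTwist (D : ℚ)).LFunction ℓ := by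
    rw [← hC, LFunction_smul]
  rw [h1, LFunction_quadraticTwist_apply_of_emod_four_eq_one E hD4 hsq hgoodv ℓ]
  push_cast
  rw [hbase ℓ hℓp]

/-- **`a_ℓ(A(11)^{(D)}) ≡ (ℓ/|D|)·(ℓ³ + ℓ⁸) (mod 11)`**, any model, `D ≡ 1 (mod 4)` squarefree, `11 ∤ D`, every prime `ℓ ≠ 11`.
[cite: SilvermanAEC2009, X.2 and Exercise 10.16] [cite: Mazur1978, Prop. 6.3 (1) (p. 153)] -/
theorem lFunction_twist_cm11_mod (W : WeierstrassCurve ℚ) [W.IsElliptic] {D : ℤ}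
    (hD4 : D % 4 = 1) (hsq : Squarefree D) (hpD : ¬ (11 : ℤ) ∣ D)
    (hW : ∃ C : VariableChange ℚ, C • W = cm11.quadraticTwist (D : ℚ))
    (ℓ : ℕ) [Fact ℓ.Prime] (h : ℓ ≠ 11) :
    ((W.LFunction ℓ : ℤ) : ZMod 11) =
      (jacobiSym (ℓ : ℤ) D.natAbs : ZMod 11) * ((ℓ : ZMod 11) ^ 3 + (ℓ : ZMod 11) ^ 8) :=
  haveI : Fact (Nat.Prime 11) := ⟨by norm_num⟩
  lFunction_twist_mod_of_traceForm cm11 11 3 8 hasGoodReductionAtPrime_cm11 lFunction_cm11_mod W hD4 hsq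
    (by exact_mod_cast hpD) hW ℓ h

/-- **`a_ℓ(A(19)^{(D)}) ≡ (ℓ/|D|)·(ℓ⁵ + ℓ¹⁴) (mod 19)`**, any model, `D ≡ 1 (mod 4)` squarefree, `19 ∤ D`, every prime `ℓ ≠ 19`.
[cite: SilvermanAEC2009, X.2 and Exercise 10.16] [cite: Mazur1978, Prop. 6.3 (1) (p. 153)] -/
theorem lFunction_twist_cm19_mod (W : WeierstrassCurve ℚ) [W.IsElliptic] {D : ℤ}
    (hD4 : D % 4 = 1) (hsq : Squarefree D) (hpD : ¬ (19 : ℤ) ∣ D)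
    (hW : ∃ C : VariableChange ℚ, C • W = cm19.quadraticTwist (D : ℚ))
    (ℓ : ℕ) [Fact ℓ.Prime] (h : ℓ ≠ 19) :
    ((W.LFunction ℓ : ℤ) : ZMod 19) =
      (jacobiSym (ℓ : ℤ) D.natAbs : ZMod 19) * ((ℓ : ZMod 19) ^ 5 + (ℓ : ZMod 19) ^ 14) :=
  haveI : Fact (Nat.Prime 19) := ⟨by norm_num⟩
  lFunction_twist_mod_of_traceForm cm19 19 5 14 hasGoodReductionAtPrime_cm19 lFunction_cm19_mod W hD4 hsq
    (by exact_mod_cast hpD) hW ℓ h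

/-- **`a_ℓ(A(43)^{(D)}) ≡ (ℓ/|D|)·(ℓ¹¹ + ℓ³²) (mod 43)`**, any model, `D ≡ 1 (mod 4)` squarefree, `43 ∤ D`, every prime `ℓ ≠ 43`.
[cite: SilvermanAEC2009, X.2 and Exercise 10.16] [cite: Mazur1978, Prop. 6.3 (1) (p. 153)] -/
theorem lFunction_twist_cm43_mod (W : WeierstrassCurve ℚ) [W.IsElliptic] {D : ℤ}
    (hD4 : D % 4 = 1) (hsq : Squarefree D) (hpD : ¬ (43 : ℤ) ∣ D)
    (hW : ∃ C : VariableChange ℚ, C • W = cm43.quadraticTwist (D : ℚ))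
    (ℓ : ℕ) [Fact ℓ.Prime] (h : ℓ ≠ 43) :
    ((W.LFunction ℓ : ℤ) : ZMod 43) =
      (jacobiSym (ℓ : ℤ) D.natAbs : ZMod 43) * ((ℓ : ZMod 43) ^ 11 + (ℓ : ZMod 43) ^ 32) :=
  haveI : Fact (Nat.Prime 43) := ⟨by norm_num⟩
  lFunction_twist_mod_of_traceForm cm43 43 11 32 hasGoodReductionAtPrime_cm43 lFunction_cm43_mod W hD4 hsq
    (by exact_mod_cast hpD) hW ℓ h

/-- **`a_ℓ(A(67)^{(D)}) ≡ (ℓ/|D|)·(ℓ¹⁷ + ℓ⁵⁰) (mod 67)`**, any model, `D ≡ 1 (mod 4)` squarefree, `67 ∤ D`, every prime `ℓ ≠ 67`.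
[cite: SilvermanAEC2009, X.2 and Exercise 10.16] [cite: Mazur1978, Prop. 6.3 (1) (p. 153)] -/
theorem lFunction_twist_cm67_mod (W : WeierstrassCurve ℚ) [W.IsElliptic] {D : ℤ}
    (hD4 : D % 4 = 1) (hsq : Squarefree D) (hpD : ¬ (67 : ℤ) ∣ D)
    (hW : ∃ C : VariableChange ℚ, C • W = cm67.quadraticTwist (D : ℚ))
    (ℓ : ℕ) [Fact ℓ.Prime] (h : ℓ ≠ 67) :
    ((W.LFunction ℓ : ℤ) : ZMod 67) =
      (jacobiSym (ℓ : ℤ) D.natAbs : ZMod 67) * ((ℓ : ZMod 67) ^ 17 + (ℓ : ZMod 67) ^ 50) :=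
  haveI : Fact (Nat.Prime 67) := ⟨by norm_num⟩
  lFunction_twist_mod_of_traceForm cm67 67 17 50 hasGoodReductionAtPrime_cm67 lFunction_cm67_mod W hD4 hsq
    (by exact_mod_cast hpD) hW ℓ h

/-- **`a_ℓ(A(163)^{(D)}) ≡ (ℓ/|D|)·(ℓ⁴¹ + ℓ¹²²) (mod 163)`**, any model, `D ≡ 1 (mod 4)` squarefree, `163 ∤ D`, every prime `ℓ ≠ 163`
(base trace form: the previous w2's `AnchorReduction.lFunction_cm163_mod`, p611699).
[cite: SilvermanAEC2009, X.2 and Exercise 10.16] [cite: Mazur1978, Prop. 6.3 (1) (p. 153)] -/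
theorem lFunction_twist_cm163_mod (W : WeierstrassCurve ℚ) [W.IsElliptic] {D : ℤ}
    (hD4 : D % 4 = 1) (hsq : Squarefree D) (hpD : ¬ (163 : ℤ) ∣ D)
    (hW : ∃ C : VariableChange ℚ, C • W = cm163.quadraticTwist (D : ℚ))
    (ℓ : ℕ) [Fact ℓ.Prime] (h : ℓ ≠ 163) :
    ((W.LFunction ℓ : ℤ) : ZMod 163) =
      (jacobiSym (ℓ : ℤ) D.natAbs : ZMod 163) * ((ℓ : ZMod 163) ^ 41 + (ℓ : ZMod 163) ^ 122) :=
  haveI : Fact (Nat.Prime 163) := ⟨by norm_num⟩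
  lFunction_twist_mod_of_traceForm cm163 163 41 122 AnchorReduction.hasGoodReductionAtPrime_cm163
    AnchorReduction.lFunction_cm163_mod W hD4 hsq (by exact_mod_cast hpD) hW ℓ h

/-! ## The `hss` binder of Kriz–Li Thm. 1.20 from the trace forms (Route U^{(p)} input, any `p`) -/

/-- **`hss` from a trace form, at any prime `p` (cell `bsd-cm`'s `RouteU.hss_of_traceForm` made generic).** Let `W/ℚ`, `p` a
prime, `ω` a Teichmüller character mod `p` with values in `ℚ_p` (`‖ω(a) − a‖_p < 1`), `ψ` any `ℚ_p`-valued Dirichlet character,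
`k₁ k₂ : ℕ`. If for every prime `ℓ ∤ pN` there is an integer `ε_ℓ` with (a) `a_ℓ(W) ≡ ε_ℓ(ℓ^{k₁} + ℓ^{k₂}) (mod p)` and (b)
`ψ(ℓ) + ψ⁻¹(ℓ)ω(ℓ) = ε_ℓ·(ω(ℓ)^{k₁} + ω(ℓ)^{k₂})`, then `‖a_ℓ − (ψ(ℓ) + ψ⁻¹(ℓ)ω(ℓ))‖_p < 1` for all primes `ℓ ∤ pN` — the
trace-form hypothesis `hss` of `KrizLi2019.thm120_padicLogHeegner_unit_of_bernoulli`.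
[cite: KrizLi2019, Thm. 1.20 and §2 (trace form of E[p]^{ss})] -/
theorem hss_of_traceForm_prime (W : WeierstrassCurve ℚ) (p : ℕ) [Fact p.Prime] (k₁ k₂ : ℕ) {f : ℕ}
    (ψ : DirichletCharacter ℚ_[p] f) (ω : DirichletCharacter ℚ_[p] p) (hω : KrizLi2019.IsTeichmullerCharacter ω) (ε : ℕ → ℤ)
    (ha : ∀ ℓ : ℕ, ℓ.Prime → ¬ (ℓ ∣ p * W.conductorNorm ℤ) →
      ((W.LFunction ℓ : ℤ) : ZMod p) = (ε ℓ : ZMod p) * ((ℓ : ZMod p) ^ k₁ + (ℓ : ZMod p) ^ k₂))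
    (hψ : ∀ ℓ : ℕ, ℓ.Prime → ¬ (ℓ ∣ p * W.conductorNorm ℤ) →
      ψ (ℓ : ZMod f) + ψ⁻¹ (ℓ : ZMod f) * ω (ℓ : ZMod p) =
        (ε ℓ : ℚ_[p]) * (ω (ℓ : ZMod p) ^ k₁ + ω (ℓ : ZMod p) ^ k₂)) :
    ∀ ℓ : ℕ, ℓ.Prime → ¬ (ℓ ∣ p * W.conductorNorm ℤ) →
      ‖((W.LFunction ℓ : ℤ) : ℚ_[p]) -
        (ψ (ℓ : ZMod f) + ψ⁻¹ (ℓ : ZMod f) * ω (ℓ : ZMod p))‖ < 1 := by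
  intro ℓ hℓ hℓN
  have hp : p.Prime := Fact.out
  have hℓp : ¬ ((p : ℤ) ∣ (ℓ : ℤ)) := by
    intro h
    have h' : p ∣ ℓ := by exact_mod_cast h
    have hpp : ℓ = p := ((Nat.prime_dvd_prime_iff_eq hp hℓ).mp h').symm
    rw [hpp] at hℓN
    exact hℓN (dvd_mul_right p _)
  rw [hψ ℓ hℓ hℓN]
  -- `ω(ℓ) ≡ ℓ`, hence `ω(ℓ)^{k₁} + ω(ℓ)^{k₂} ≡ ℓ^{k₁} + ℓ^{k₂} (mod pℤ_p)`
  have hωℓ : ‖ω (ℓ : ZMod p) - (ℓ : ℚ_[p])‖ < 1 := by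
    have := hω (ℓ : ℤ) hℓp
    push_cast at this
    exact this
  have hω1 : ‖ω (ℓ : ZMod p)‖ ≤ 1 :=
    RouteU.norm_le_one_of_norm_sub_intCast_lt_one (a := ℓ) (by push_cast; exact hωℓ)
  have hℓ1 : ‖(ℓ : ℚ_[p])‖ ≤ 1 := by exact_mod_cast Padic.norm_int_le_one (ℓ : ℤ)
  have hS : ‖(ω (ℓ : ZMod p) ^ k₁ + ω (ℓ : ZMod p) ^ k₂) - ((ℓ : ℚ_[p]) ^ k₁ + (ℓ : ℚ_[p]) ^ k₂)‖ < 1 := by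
    have e : (ω (ℓ : ZMod p) ^ k₁ + ω (ℓ : ZMod p) ^ k₂) - ((ℓ : ℚ_[p]) ^ k₁ + (ℓ : ℚ_[p]) ^ k₂) =
        (ω (ℓ : ZMod p) ^ k₁ - (ℓ : ℚ_[p]) ^ k₁) + (ω (ℓ : ZMod p) ^ k₂ - (ℓ : ℚ_[p]) ^ k₂) := by ring
    rw [e]
    exact (Padic.nonarchimedean _ _).trans_lt
      (max_lt (RouteU.norm_pow_sub_pow_lt_one hω1 hℓ1 hωℓ k₁) (RouteU.norm_pow_sub_pow_lt_one hω1 hℓ1 hωℓ k₂))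
  -- `a_ℓ ≡ ε_ℓ(ℓ^{k₁} + ℓ^{k₂}) (mod p)` as an integer congruence
  have hA : ‖((W.LFunction ℓ : ℤ) : ℚ_[p]) - (ε ℓ : ℚ_[p]) * ((ℓ : ℚ_[p]) ^ k₁ + (ℓ : ℚ_[p]) ^ k₂)‖ < 1 := by
    have h0 : ((W.LFunction ℓ - ε ℓ * ((ℓ : ℤ) ^ k₁ + (ℓ : ℤ) ^ k₂) : ℤ) : ZMod p) = 0 := by
      push_cast
      rw [ha ℓ hℓ hℓN, sub_self]
    have hdvd : ((p : ℕ) : ℤ) ∣ W.LFunction ℓ - ε ℓ * ((ℓ : ℤ) ^ k₁ + (ℓ : ℤ) ^ k₂) :=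
      (ZMod.intCast_zmod_eq_zero_iff_dvd _ p).mp h0
    have := (Padic.norm_intCast_lt_one_iff (p := p)).mpr hdvd
    push_cast at this
    exact this
  -- `ε_ℓ·(ω^{k₁} + ω^{k₂}) ≡ ε_ℓ·(ℓ^{k₁} + ℓ^{k₂})`
  have hB : ‖(ε ℓ : ℚ_[p]) * ((ℓ : ℚ_[p]) ^ k₁ + (ℓ : ℚ_[p]) ^ k₂) -
      (ε ℓ : ℚ_[p]) * (ω (ℓ : ZMod p) ^ k₁ + ω (ℓ : ZMod p) ^ k₂)‖ < 1 := by
    rw [← mul_sub, norm_mul, norm_sub_rev]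
    calc ‖(ε ℓ : ℚ_[p])‖ * ‖(ω (ℓ : ZMod p) ^ k₁ + ω (ℓ : ZMod p) ^ k₂) - ((ℓ : ℚ_[p]) ^ k₁ + (ℓ : ℚ_[p]) ^ k₂)‖
        ≤ 1 * ‖(ω (ℓ : ZMod p) ^ k₁ + ω (ℓ : ZMod p) ^ k₂) - ((ℓ : ℚ_[p]) ^ k₁ + (ℓ : ℚ_[p]) ^ k₂)‖ :=
          mul_le_mul_of_nonneg_right (Padic.norm_int_le_one _) (norm_nonneg _)
      _ < 1 := by rw [one_mul]; exact hS
  have e : ((W.LFunction ℓ : ℤ) : ℚ_[p]) - (ε ℓ : ℚ_[p]) * (ω (ℓ : ZMod p) ^ k₁ + ω (ℓ : ZMod p) ^ k₂) =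
      (((W.LFunction ℓ : ℤ) : ℚ_[p]) - (ε ℓ : ℚ_[p]) * ((ℓ : ℚ_[p]) ^ k₁ + (ℓ : ℚ_[p]) ^ k₂)) +
      ((ε ℓ : ℚ_[p]) * ((ℓ : ℚ_[p]) ^ k₁ + (ℓ : ℚ_[p]) ^ k₂) -
        (ε ℓ : ℚ_[p]) * (ω (ℓ : ZMod p) ^ k₁ + ω (ℓ : ZMod p) ^ k₂)) := by ring
  rw [e]
  exact (Padic.nonarchimedean _ _).trans_lt (max_lt hA hB)


/-- **`hss` for the odd-Heegner twists of `A(11)`** (Route U^{(11)} input): for ANY model `W` of `A(11)^{(D)}` (`D ≡ 1 (mod 4)`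
squarefree, `11 ∤ D`), a Teichmüller character `ω` mod `11` and a `ℚ_11`-valued Dirichlet character `ψ` with
`ψ(ℓ) + ψ⁻¹(ℓ)ω(ℓ) = (ℓ/|D|)·(ω(ℓ)^3 + ω(ℓ)^8)` at the primes `ℓ ∤ 11·N_W` (e.g. `ψ = χ_D ω^3` or `χ_D ω^8`): the `hss`
binder of `KrizLi2019.thm120_padicLogHeegner_unit_of_bernoulli` holds. [cite: KrizLi2019, Thm. 1.20, Rem. 1.21 and §2]
[cite: Mazur1978, Prop. 6.3 (1) (p. 153)] -/
theorem hss_twist_cm11 [Fact (Nat.Prime 11)] (W : WeierstrassCurve ℚ) [W.IsElliptic] {D : ℤ}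
    (hD4 : D % 4 = 1) (hsq : Squarefree D) (hpD : ¬ (11 : ℤ) ∣ D)
    (hW : ∃ C : VariableChange ℚ, C • W = cm11.quadraticTwist (D : ℚ))
    {f : ℕ} (ψ : DirichletCharacter ℚ_[11] f) (ω : DirichletCharacter ℚ_[11] 11)
    (hω : KrizLi2019.IsTeichmullerCharacter ω)
    (hψ : ∀ ℓ : ℕ, ℓ.Prime → ¬ (ℓ ∣ 11 * W.conductorNorm ℤ) →
      ψ (ℓ : ZMod f) + ψ⁻¹ (ℓ : ZMod f) * ω (ℓ : ZMod 11) =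
        (jacobiSym (ℓ : ℤ) D.natAbs : ℚ_[11]) * (ω (ℓ : ZMod 11) ^ 3 + ω (ℓ : ZMod 11) ^ 8)) :
    ∀ ℓ : ℕ, ℓ.Prime → ¬ (ℓ ∣ 11 * W.conductorNorm ℤ) →
      ‖((W.LFunction ℓ : ℤ) : ℚ_[11]) - (ψ (ℓ : ZMod f) + ψ⁻¹ (ℓ : ZMod f) * ω (ℓ : ZMod 11))‖ < 1 := by
  refine hss_of_traceForm_prime W 11 3 8 ψ ω hω (fun ℓ => jacobiSym (ℓ : ℤ) D.natAbs)
    (fun ℓ hℓ hℓN => ?_) hψ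
  haveI : Fact ℓ.Prime := ⟨hℓ⟩
  have hne : ℓ ≠ 11 := by rintro rfl; exact hℓN (dvd_mul_right 11 _)
  exact lFunction_twist_cm11_mod W hD4 hsq hpD hW ℓ hne

/-- **`hss` for the odd-Heegner twists of `A(19)`** (Route U^{(19)} input): for ANY model `W` of `A(19)^{(D)}` (`D ≡ 1 (mod 4)`
squarefree, `19 ∤ D`), a Teichmüller character `ω` mod `19` and a `ℚ_19`-valued Dirichlet character `ψ` with
`ψ(ℓ) + ψ⁻¹(ℓ)ω(ℓ) = (ℓ/|D|)·(ω(ℓ)^5 + ω(ℓ)^14)` at the primes `ℓ ∤ 19·N_W` (e.g. `ψ = χ_D ω^5` or `χ_D ω^14`): the `hss`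
binder of `KrizLi2019.thm120_padicLogHeegner_unit_of_bernoulli` holds. [cite: KrizLi2019, Thm. 1.20, Rem. 1.21 and §2]
[cite: Mazur1978, Prop. 6.3 (1) (p. 153)] -/
theorem hss_twist_cm19 [Fact (Nat.Prime 19)] (W : WeierstrassCurve ℚ) [W.IsElliptic] {D : ℤ}
    (hD4 : D % 4 = 1) (hsq : Squarefree D) (hpD : ¬ (19 : ℤ) ∣ D)
    (hW : ∃ C : VariableChange ℚ, C • W = cm19.quadraticTwist (D : ℚ))
    {f : ℕ} (ψ : DirichletCharacter ℚ_[19] f) (ω : DirichletCharacter ℚ_[19] 19)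
    (hω : KrizLi2019.IsTeichmullerCharacter ω)
    (hψ : ∀ ℓ : ℕ, ℓ.Prime → ¬ (ℓ ∣ 19 * W.conductorNorm ℤ) →
      ψ (ℓ : ZMod f) + ψ⁻¹ (ℓ : ZMod f) * ω (ℓ : ZMod 19) =
        (jacobiSym (ℓ : ℤ) D.natAbs : ℚ_[19]) * (ω (ℓ : ZMod 19) ^ 5 + ω (ℓ : ZMod 19) ^ 14)) :
    ∀ ℓ : ℕ, ℓ.Prime → ¬ (ℓ ∣ 19 * W.conductorNorm ℤ) →
      ‖((W.LFunction ℓ : ℤ) : ℚ_[19]) - (ψ (ℓ : ZMod f) + ψ⁻¹ (ℓ : ZMod f) * ω (ℓ : ZMod 19))‖ < 1 := by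
  refine hss_of_traceForm_prime W 19 5 14 ψ ω hω (fun ℓ => jacobiSym (ℓ : ℤ) D.natAbs)
    (fun ℓ hℓ hℓN => ?_) hψ
  haveI : Fact ℓ.Prime := ⟨hℓ⟩
  have hne : ℓ ≠ 19 := by rintro rfl; exact hℓN (dvd_mul_right 19 _)
  exact lFunction_twist_cm19_mod W hD4 hsq hpD hW ℓ hne

/-- **`hss` for the odd-Heegner twists of `A(43)`** (Route U^{(43)} input): for ANY model `W` of `A(43)^{(D)}` (`D ≡ 1 (mod 4)`
squarefree, `43 ∤ D`), a Teichmüller character `ω` mod `43` and a `ℚ_43`-valued Dirichlet character `ψ` with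
`ψ(ℓ) + ψ⁻¹(ℓ)ω(ℓ) = (ℓ/|D|)·(ω(ℓ)^11 + ω(ℓ)^32)` at the primes `ℓ ∤ 43·N_W` (e.g. `ψ = χ_D ω^11` or `χ_D ω^32`): the `hss`
binder of `KrizLi2019.thm120_padicLogHeegner_unit_of_bernoulli` holds. [cite: KrizLi2019, Thm. 1.20, Rem. 1.21 and §2]
[cite: Mazur1978, Prop. 6.3 (1) (p. 153)] -/
theorem hss_twist_cm43 [Fact (Nat.Prime 43)] (W : WeierstrassCurve ℚ) [W.IsElliptic] {D : ℤ}
    (hD4 : D % 4 = 1) (hsq : Squarefree D) (hpD : ¬ (43 : ℤ) ∣ D)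
    (hW : ∃ C : VariableChange ℚ, C • W = cm43.quadraticTwist (D : ℚ))
    {f : ℕ} (ψ : DirichletCharacter ℚ_[43] f) (ω : DirichletCharacter ℚ_[43] 43)
    (hω : KrizLi2019.IsTeichmullerCharacter ω)
    (hψ : ∀ ℓ : ℕ, ℓ.Prime → ¬ (ℓ ∣ 43 * W.conductorNorm ℤ) →
      ψ (ℓ : ZMod f) + ψ⁻¹ (ℓ : ZMod f) * ω (ℓ : ZMod 43) =
        (jacobiSym (ℓ : ℤ) D.natAbs : ℚ_[43]) * (ω (ℓ : ZMod 43) ^ 11 + ω (ℓ : ZMod 43) ^ 32)) :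
    ∀ ℓ : ℕ, ℓ.Prime → ¬ (ℓ ∣ 43 * W.conductorNorm ℤ) →
      ‖((W.LFunction ℓ : ℤ) : ℚ_[43]) - (ψ (ℓ : ZMod f) + ψ⁻¹ (ℓ : ZMod f) * ω (ℓ : ZMod 43))‖ < 1 := by
  refine hss_of_traceForm_prime W 43 11 32 ψ ω hω (fun ℓ => jacobiSym (ℓ : ℤ) D.natAbs)
    (fun ℓ hℓ hℓN => ?_) hψ
  haveI : Fact ℓ.Prime := ⟨hℓ⟩
  have hne : ℓ ≠ 43 := by rintro rfl; exact hℓN (dvd_mul_right 43 _)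
  exact lFunction_twist_cm43_mod W hD4 hsq hpD hW ℓ hne

/-- **`hss` for the odd-Heegner twists of `A(67)`** (Route U^{(67)} input): for ANY model `W` of `A(67)^{(D)}` (`D ≡ 1 (mod 4)`
squarefree, `67 ∤ D`), a Teichmüller character `ω` mod `67` and a `ℚ_67`-valued Dirichlet character `ψ` with
`ψ(ℓ) + ψ⁻¹(ℓ)ω(ℓ) = (ℓ/|D|)·(ω(ℓ)^17 + ω(ℓ)^50)` at the primes `ℓ ∤ 67·N_W` (e.g. `ψ = χ_D ω^17` or `χ_D ω^50`): the `hss`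
binder of `KrizLi2019.thm120_padicLogHeegner_unit_of_bernoulli` holds. [cite: KrizLi2019, Thm. 1.20, Rem. 1.21 and §2]
[cite: Mazur1978, Prop. 6.3 (1) (p. 153)] -/
theorem hss_twist_cm67 [Fact (Nat.Prime 67)] (W : WeierstrassCurve ℚ) [W.IsElliptic] {D : ℤ}
    (hD4 : D % 4 = 1) (hsq : Squarefree D) (hpD : ¬ (67 : ℤ) ∣ D)
    (hW : ∃ C : VariableChange ℚ, C • W = cm67.quadraticTwist (D : ℚ))
    {f : ℕ} (ψ : DirichletCharacter ℚ_[67] f) (ω : DirichletCharacter ℚ_[67] 67)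
    (hω : KrizLi2019.IsTeichmullerCharacter ω)
    (hψ : ∀ ℓ : ℕ, ℓ.Prime → ¬ (ℓ ∣ 67 * W.conductorNorm ℤ) →
      ψ (ℓ : ZMod f) + ψ⁻¹ (ℓ : ZMod f) * ω (ℓ : ZMod 67) =
        (jacobiSym (ℓ : ℤ) D.natAbs : ℚ_[67]) * (ω (ℓ : ZMod 67) ^ 17 + ω (ℓ : ZMod 67) ^ 50)) :
    ∀ ℓ : ℕ, ℓ.Prime → ¬ (ℓ ∣ 67 * W.conductorNorm ℤ) →
      ‖((W.LFunction ℓ : ℤ) : ℚ_[67]) - (ψ (ℓ : ZMod f) + ψ⁻¹ (ℓ : ZMod f) * ω (ℓ : ZMod 67))‖ < 1 := by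
  refine hss_of_traceForm_prime W 67 17 50 ψ ω hω (fun ℓ => jacobiSym (ℓ : ℤ) D.natAbs)
    (fun ℓ hℓ hℓN => ?_) hψ
  haveI : Fact ℓ.Prime := ⟨hℓ⟩
  have hne : ℓ ≠ 67 := by rintro rfl; exact hℓN (dvd_mul_right 67 _)
  exact lFunction_twist_cm67_mod W hD4 hsq hpD hW ℓ hne

/-- **`hss` for the odd-Heegner twists of `A(163)`** (Route U^{(163)} input): for ANY model `W` of `A(163)^{(D)}` (`D ≡ 1 (mod 4)`
squarefree, `163 ∤ D`), a Teichmüller character `ω` mod `163` and a `ℚ_163`-valued Dirichlet character `ψ` with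
`ψ(ℓ) + ψ⁻¹(ℓ)ω(ℓ) = (ℓ/|D|)·(ω(ℓ)^41 + ω(ℓ)^122)` at the primes `ℓ ∤ 163·N_W` (e.g. `ψ = χ_D ω^41` or `χ_D ω^122`): the `hss`
binder of `KrizLi2019.thm120_padicLogHeegner_unit_of_bernoulli` holds. [cite: KrizLi2019, Thm. 1.20, Rem. 1.21 and §2]
[cite: Mazur1978, Prop. 6.3 (1) (p. 153)] -/
theorem hss_twist_cm163 [Fact (Nat.Prime 163)] (W : WeierstrassCurve ℚ) [W.IsElliptic] {D : ℤ}
    (hD4 : D % 4 = 1) (hsq : Squarefree D) (hpD : ¬ (163 : ℤ) ∣ D)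
    (hW : ∃ C : VariableChange ℚ, C • W = cm163.quadraticTwist (D : ℚ))
    {f : ℕ} (ψ : DirichletCharacter ℚ_[163] f) (ω : DirichletCharacter ℚ_[163] 163)
    (hω : KrizLi2019.IsTeichmullerCharacter ω)
    (hψ : ∀ ℓ : ℕ, ℓ.Prime → ¬ (ℓ ∣ 163 * W.conductorNorm ℤ) →
      ψ (ℓ : ZMod f) + ψ⁻¹ (ℓ : ZMod f) * ω (ℓ : ZMod 163) =
        (jacobiSym (ℓ : ℤ) D.natAbs : ℚ_[163]) * (ω (ℓ : ZMod 163) ^ 41 + ω (ℓ : ZMod 163) ^ 122)) :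
    ∀ ℓ : ℕ, ℓ.Prime → ¬ (ℓ ∣ 163 * W.conductorNorm ℤ) →
      ‖((W.LFunction ℓ : ℤ) : ℚ_[163]) - (ψ (ℓ : ZMod f) + ψ⁻¹ (ℓ : ZMod f) * ω (ℓ : ZMod 163))‖ < 1 := by
  refine hss_of_traceForm_prime W 163 41 122 ψ ω hω (fun ℓ => jacobiSym (ℓ : ℤ) D.natAbs)
    (fun ℓ hℓ hℓN => ?_) hψ
  haveI : Fact ℓ.Prime := ⟨hℓ⟩
  have hne : ℓ ≠ 163 := by rintro rfl; exact hℓN (dvd_mul_right 163 _)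
  exact lFunction_twist_cm163_mod W hD4 hsq hpD hW ℓ hne

end Summit.BirchSwinnertonDyer.BirchSwinnertonDyer.Theorems.PrintCFram.EisensteinTraceForm

end
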